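import Mathlib
import Summits.Ventures.HodgeRepro.Tier4.Line1.RTFSetting
import Summits.Ventures.HodgeRepro.Tier4.Line1.GeneratedSubspace
import Summits.Ventures.HodgeRepro.Tier4.Line1.BlockSimple
import Summits.Ventures.HodgeRepro.Tier4.Line1.BlockConstituents
import Summits.Ventures.HodgeRepro.Tier4.Line1.BlockDecomposition

/-!
# Tier4/Line1/BlockProjections — (C-PROJ) in the NON-∃ FORM: the nine clauses of `exists_block_decomposition` as
named theorems about the DEFINED `blockSupport` / `blockProj` (plan-1's seam check S14424 (3): the consumer's `hM` over
`↥s` needs `s := blockSupport …`, `P := blockProj …` by name, not destructed from an `∃`)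

Blind re-derivation cell `pub-hodge-repro`, Tier 4 (README §9–§10), seat t4-L1-p3 (prover, LINE L1, gen 3).  Target tree
path `lean/Summits/Ventures/HodgeRepro/Tier4/Line1/BlockProjections.lean`.  Imports this seat's `BlockDecomposition`
(p693709: `blockSupport`, `blockProj`, `blockComp`, `blockComp_eq_of_sum`, `sum_blockComp`, …) and `BlockConstituents`
(p693204).  0 printed inputs.  The proofs are the nine proof blocks of `exists_block_decomposition`, one per theorem:
`blockProj_mem_Vb`, `blockProj_mem_tau` (on the support), `blockProj_add`, `blockProj_smul`, `sum_blockProj`,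
`blockProj_of_mem_tau`, `blockProj_eq_zero_of_mem_tau`, `blockProj_R_comm` (for every `R(f)` preserving `Vb`),
`mem_blockSupport_of_exists`.  Nothing here moves (P).  Nothing here says anything about the status of the Hodge
conjecture for CM abelian varieties, which is NOT proved (HC_CM is NOT proved by anyone in this repository).
-/

set_option autoImplicit false

noncomputable section

namespace Summit.Ventures.HodgeRepro.Tier4.Line1

open MeasureTheory Topology Set DirectSum

namespace RTF.Setting

variable {G : Type} [Group G] [TopologicalSpace G] [IsTopologicalGroup G] [MeasurableSpace G] [BorelSpace G]
  (S : Setting G)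

section Projections

variable {τ : ℕ → Set (G → ℂ)} {φ : ℕ → G → ℂ} {n : ℕ → ℕ} (hB : S.IsAdaptedONB τ φ n)
  {e : G → ℂ} (Vb : Submodule ℂ (G → ℂ))
  (hVb : ∀ ψ, ψ ∈ Vb ↔ S.Invariant ψ ∧ Continuous ψ ∧ S.R e ψ = ψ)
  [Countable S.Gk] [SecondCountableTopology G] [T2Space G] [MeasurableMul G] [SFinite S.μ]
  [FiniteDimensional ℂ Vb] (he : IsTest e) (he_conv : S.conv e e = e) (he_sym : cj (refl e) = e)

include hB he he_conv he_sym hVb in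
/-- (clause 1) the projections land in the block. -/
theorem blockProj_mem_Vb :
    ∀ m, ∀ ψ ∈ Vb, blockProj S hB Vb hVb he he_conv he_sym m ψ ∈ Vb := by
  classical
  intro m ψ hψ
  by_cases hm : m ∈ blockSupport S hB Vb hVb
  · rw [S.blockProj_of_mem hB Vb hVb he he_conv he_sym hψ hm]
    exact S.blockComp_mem_Vb hB Vb hVb he he_conv he_sym hψ _
  · rw [S.blockProj_of_not_mem_support hB Vb hVb he he_conv he_sym ψ hm]
    exact Vb.zero_mem

include hB he he_conv he_sym hVb in
/-- (clause 2) on the support, the projections land in the constituent. -/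
theorem blockProj_mem_tau :
    ∀ m ∈ blockSupport S hB Vb hVb, ∀ ψ ∈ Vb, blockProj S hB Vb hVb he he_conv he_sym m ψ ∈ τ m := by
  classical
  intro m hm ψ hψ
  rw [S.blockProj_of_mem hB Vb hVb he he_conv he_sym hψ hm]
  rcases (S.blockComp_mem hB Vb hVb he he_conv he_sym hψ ⟨m, hm⟩).2 with h | h
  · exact h
  · rw [h]
    exact S.zero_mem_tau_of_Wm_ne_bot hB Vb ((S.mem_blockSupport hB Vb hVb).mp hm)

include hB he he_conv he_sym hVb in
/-- (clause 3) the projections are additive on the block. -/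
theorem blockProj_add :
    ∀ m, ∀ ψ ∈ Vb, ∀ ψ' ∈ Vb, blockProj S hB Vb hVb he he_conv he_sym m (ψ + ψ') = blockProj S hB Vb hVb he he_conv he_sym m ψ + blockProj S hB Vb hVb he he_conv he_sym m ψ' := by
  classical
  intro m ψ hψ ψ' hψ'
  by_cases hm : m ∈ blockSupport S hB Vb hVb
  · rw [S.blockProj_of_mem hB Vb hVb he he_conv he_sym (Vb.add_mem hψ hψ') hm,
      S.blockProj_of_mem hB Vb hVb he he_conv he_sym hψ hm, S.blockProj_of_mem hB Vb hVb he he_conv he_sym hψ' hm]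
    refine S.blockComp_eq_of_sum hB Vb hVb he he_conv he_sym (Vb.add_mem hψ hψ')
      (fun i => blockComp S hB Vb hVb he he_conv he_sym hψ i + blockComp S hB Vb hVb he he_conv he_sym hψ' i)
      (fun i => (constituentFamily S hB Vb hVb i).add_mem (S.blockComp_mem hB Vb hVb he he_conv he_sym hψ i)
        (S.blockComp_mem hB Vb hVb he he_conv he_sym hψ' i)) ?_ ⟨m, hm⟩
    rw [Finset.sum_add_distrib, S.sum_blockComp hB Vb hVb he he_conv he_sym hψ,
      S.sum_blockComp hB Vb hVb he he_conv he_sym hψ']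
  · simp only [S.blockProj_of_not_mem_support hB Vb hVb he he_conv he_sym _ hm, add_zero]

include hB he he_conv he_sym hVb in
/-- (clause 4) the projections are homogeneous on the block. -/
theorem blockProj_smul :
    ∀ m, ∀ ψ ∈ Vb, ∀ c : ℂ, blockProj S hB Vb hVb he he_conv he_sym m (c • ψ) = c • blockProj S hB Vb hVb he he_conv he_sym m ψ := by
  classical
  intro m ψ hψ c
  by_cases hm : m ∈ blockSupport S hB Vb hVb
  · rw [S.blockProj_of_mem hB Vb hVb he he_conv he_sym (Vb.smul_mem c hψ) hm,
      S.blockProj_of_mem hB Vb hVb he he_conv he_sym hψ hm]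
    refine S.blockComp_eq_of_sum hB Vb hVb he he_conv he_sym (Vb.smul_mem c hψ)
      (fun i => c • blockComp S hB Vb hVb he he_conv he_sym hψ i)
      (fun i => (constituentFamily S hB Vb hVb i).smul_mem c (S.blockComp_mem hB Vb hVb he he_conv he_sym hψ i))
      ?_ ⟨m, hm⟩
    rw [← Finset.smul_sum, S.sum_blockComp hB Vb hVb he he_conv he_sym hψ]
  · simp only [S.blockProj_of_not_mem_support hB Vb hVb he he_conv he_sym _ hm, smul_zero]

include hB he he_conv he_sym hVb in
/-- (clause 5) the projections sum to the identity on the block. -/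
theorem sum_blockProj :
    ∀ ψ ∈ Vb, ∑ m ∈ blockSupport S hB Vb hVb, blockProj S hB Vb hVb he he_conv he_sym m ψ = ψ := by
  classical
  intro ψ hψ
  rw [← Finset.sum_coe_sort (blockSupport S hB Vb hVb) (fun m => blockProj S hB Vb hVb he he_conv he_sym m ψ)]
  have : ∀ i : ↥(blockSupport S hB Vb hVb),
      blockProj S hB Vb hVb he he_conv he_sym (i : ℕ) ψ = blockComp S hB Vb hVb he he_conv he_sym hψ i := fun i => by
    rw [S.blockProj_of_mem hB Vb hVb he he_conv he_sym hψ i.2]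
  simp only [this]
  exact S.sum_blockComp hB Vb hVb he he_conv he_sym hψ

include hB he he_conv he_sym hVb in
/-- (clause 6) the identity on `Vb ∩ τ m`. -/
theorem blockProj_of_mem_tau :
    ∀ m, ∀ ψ ∈ Vb, ψ ∈ τ m → blockProj S hB Vb hVb he he_conv he_sym m ψ = ψ := by
  classical
  intro m ψ hψ hτ
  by_cases hm : m ∈ blockSupport S hB Vb hVb
  · rw [S.blockProj_of_mem hB Vb hVb he he_conv he_sym hψ hm]
    have := S.blockComp_eq_of_sum hB Vb hVb he he_conv he_sym hψ
      (fun i => if i = ⟨m, hm⟩ then ψ else 0)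
      (fun i => by
        by_cases hi : i = ⟨m, hm⟩
        · rw [if_pos hi, hi]
          exact ⟨hψ, Or.inl hτ⟩
        · rw [if_neg hi]
          exact (constituentFamily S hB Vb hVb i).zero_mem)
      (by simp) ⟨m, hm⟩
    rw [this, if_pos rfl]
  · have hbot : Wm S hB Vb m = ⊥ := by
      by_contra h
      exact hm ((S.mem_blockSupport hB Vb hVb).mpr h)
    have hψ0 : ψ = 0 := by
      have : ψ ∈ Wm S hB Vb m := ⟨hψ, Or.inl hτ⟩
      rw [hbot, Submodule.mem_bot] at this
      exact this
    rw [S.blockProj_of_not_mem_support hB Vb hVb he he_conv he_sym ψ hm, hψ0]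

include hB he he_conv he_sym hVb in
/-- (clause 7) zero on `Vb ∩ τ m'` for `m ≠ m'`. -/
theorem blockProj_eq_zero_of_mem_tau :
    ∀ m m', m ≠ m' → ∀ ψ ∈ Vb, ψ ∈ τ m' → blockProj S hB Vb hVb he he_conv he_sym m ψ = 0 := by
  classical
  intro m m' hmm ψ hψ hτ'
  by_cases hm : m ∈ blockSupport S hB Vb hVb
  · by_cases hm' : m' ∈ blockSupport S hB Vb hVb
    · rw [S.blockProj_of_mem hB Vb hVb he he_conv he_sym hψ hm]
      have := S.blockComp_eq_of_sum hB Vb hVb he he_conv he_sym hψ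
        (fun i => if i = ⟨m', hm'⟩ then ψ else 0)
        (fun i => by
          by_cases hi : i = ⟨m', hm'⟩
          · rw [if_pos hi, hi]
            exact ⟨hψ, Or.inl hτ'⟩
          · rw [if_neg hi]
            exact (constituentFamily S hB Vb hVb i).zero_mem)
        (by simp) ⟨m, hm⟩
      rw [this, if_neg]
      intro h
      exact hmm (congrArg Subtype.val h)
    · have hbot : Wm S hB Vb m' = ⊥ := by
        by_contra h
        exact hm' ((S.mem_blockSupport hB Vb hVb).mpr h)
      have hψ0 : ψ = 0 := by
        have : ψ ∈ Wm S hB Vb m' := ⟨hψ, Or.inl hτ'⟩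
        rw [hbot, Submodule.mem_bot] at this
        exact this
      rw [hψ0, S.blockProj_of_mem hB Vb hVb he he_conv he_sym Vb.zero_mem hm]
      exact S.blockComp_eq_of_sum hB Vb hVb he he_conv he_sym Vb.zero_mem (fun _ => 0)
        (fun i => (constituentFamily S hB Vb hVb i).zero_mem) (by simp) ⟨m, hm⟩
  · exact S.blockProj_of_not_mem_support hB Vb hVb he he_conv he_sym ψ hm

include hB he he_conv he_sym hVb in
/-- (clause 8) commutation with every `R(f)` preserving the block. -/
theorem blockProj_R_comm :
    ∀ m, ∀ f, IsTest f → (∀ ψ ∈ Vb, S.R f ψ ∈ Vb) → ∀ ψ ∈ Vb, blockProj S hB Vb hVb he he_conv he_sym m (S.R f ψ) = S.R f (blockProj S hB Vb hVb he he_conv he_sym m ψ) := by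
  classical
  intro m f hf hpres ψ hψ
  by_cases hm : m ∈ blockSupport S hB Vb hVb
  · rw [S.blockProj_of_mem hB Vb hVb he he_conv he_sym (hpres ψ hψ) hm,
      S.blockProj_of_mem hB Vb hVb he he_conv he_sym hψ hm]
    refine S.blockComp_eq_of_sum hB Vb hVb he he_conv he_sym (hpres ψ hψ)
      (fun i => S.R f (blockComp S hB Vb hVb he he_conv he_sym hψ i)) ?_ ?_ ⟨m, hm⟩
    · intro i
      refine ⟨hpres _ (S.blockComp_mem_Vb hB Vb hVb he he_conv he_sym hψ i), ?_⟩
      rcases (S.blockComp_mem hB Vb hVb he he_conv he_sym hψ i).2 with h | h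
      · exact Or.inl ((hB.inv i).conv _ h f hf)
      · rw [h, S.R_zero']
        exact Or.inr rfl
    · conv_lhs => rw [← S.sum_blockComp hB Vb hVb he he_conv he_sym hψ]
      exact S.R_finset_sum' Finset.univ hf _ fun i _ =>
        S.continuous_of_mem_Vb Vb hVb (S.blockComp_mem_Vb hB Vb hVb he he_conv he_sym hψ i)
  · rw [S.blockProj_of_not_mem_support hB Vb hVb he he_conv he_sym _ hm,
      S.blockProj_of_not_mem_support hB Vb hVb he he_conv he_sym _ hm, S.R_zero']

omit [SecondCountableTopology G] [T2Space G] [MeasurableMul G] [SFinite S.μ] in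
include hB hVb in
/-- (clause 9) a constituent meeting the block non-trivially is in the support. -/
theorem mem_blockSupport_of_exists :
    ∀ m, (∃ ψ ∈ Vb, ψ ∈ τ m ∧ ψ ≠ 0) → m ∈ blockSupport S hB Vb hVb := by
  classical
  rintro m ⟨ψ, hψ, hτ, hne⟩
  rw [S.mem_blockSupport hB Vb hVb]
  exact (Submodule.ne_bot_iff _).mpr ⟨ψ, ⟨hψ, Or.inl hτ⟩, hne⟩

end Projections

end RTF.Setting

end Summit.Ventures.HodgeRepro.Tier4.Line1
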